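import Mathlib
import Summits.KontsevichZagierPeriods.KontsevichZagierPeriods.Theorems.SoloInformedLocusSide
import Summits.KontsevichZagierPeriods.KontsevichZagierPeriods.Theorems.SoloInformedLogRoomBand
import HarnessLib

/-!
# Solo-informed (A390-ii): integrability loci — a prepared band

File F5c of the KERNEL LEMMA I programme; the locus counterpart of `SoloInformedLogRoomBand`.
For a band `D = bandOver B ξ j` over a `ℚ`-semialgebraic base `B ⊆ ℝ^{k+m}` and a function `F`
carrying Lion–Rolin data over `B`, the locus `{t ∈ ℝᵏ | ∫ 1_D |F| (t, x) dx < ∞}` is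
`ℚ`-semialgebraic — granted LEMMA I (`SoloInformedFinLocusAt k m`) and the log-room theorem
(`SoloInformedLogRoomAt k m`) one dimension down (`soloInformed_band_locus`).
-/

open MeasureTheory Set Real
open scoped ENNReal
open Literature.ModelTheory.ExponentialFields Literature.NumberTheory.Transcendental

namespace Summit.KontsevichZagierPeriods.KontsevichZagierPeriods.Theorems

variable {k m l : ℕ} {B : Set (Fin (k + m) → ℝ)} {ξ : Fin l → (Fin (k + m) → ℝ) → ℝ}
  {j : Fin (l + 1)} {F : (Fin (k + m + 1) → ℝ) → ℝ} {H₀W : (Fin (k + m) → ℝ) → ℝ≥0∞} {c : ℝ}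

/-- **The locus bundle over the base of a prepared band**, from the two-sided mass bounds. -/
theorem soloInformed_band_locusHyp (hB : IsSemialgebraic ℚ B)
    (hξ : ∀ i, IsSemialgebraicFunOn ℚ B (ξ i)) (d₀ : SoloInformedLRData B (bandOver B ξ j) F)
    {H₀ : (Fin (k + m + 1) → ℝ) → ℝ≥0∞} (hH₀m : Measurable H₀)
    (hH₀ : ∀ z ∈ bandOver B ξ j, H₀ z = ENNReal.ofReal |F z|) :
    SoloInformedLocusHyp B d₀.a (soloInformedBandHW B ξ j H₀) (soloInformedBandI d₀) d₀.c := by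
  refine ⟨hB, d₀.a_sa, soloInformed_measurable_bandHW
    (soloInformed_isSemialgebraic_bandOver hB hξ j).measurableSet_holds hH₀m,
    zero_le_one.trans d₀.one_le_c, fun w hw => ?_⟩
  rw [soloInformed_bandHW_congr hH₀ hw]
  exact soloInformed_band_mass_bounds d₀ hw

/-- Whole-line fibres (`j = 0 = last`): the base is empty, the locus is everything. -/
theorem soloInformed_band_locus_line (d₀ : SoloInformedLRData B (bandOver B ξ j) F)
    (hj0 : j = 0) (hjl : j = Fin.last l) :
    IsSemialgebraic ℚ {t : Fin k → ℝ | ∫⁻ x, B.indicator H₀W (Fin.append t x) < ∞} := by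
  have h : {t : Fin k → ℝ | ∫⁻ x, B.indicator H₀W (Fin.append t x) < ∞} = univ :=
    eq_univ_of_forall fun t => soloInformed_band_sides_line d₀ hj0 hjl t
  rw [h]
  exact isSemialgebraic_univ

/-- Lower half-line fibres (`j = 0 ≠ last`). -/
theorem soloInformed_band_locus_lower (ihI : SoloInformedFinLocusAt k m)
    (hB : IsSemialgebraic ℚ B) (hξ : ∀ i, IsSemialgebraicFunOn ℚ B (ξ i))
    (d₀ : SoloInformedLRData B (bandOver B ξ j) F)
    (hS : SoloInformedLocusHyp B d₀.a H₀W (soloInformedBandI d₀) c)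
    (hj0 : j = 0) (hjl : j ≠ Fin.last l) :
    IsSemialgebraic ℚ {t : Fin k → ℝ | ∫⁻ x, B.indicator H₀W (Fin.append t x) < ∞} := by
  subst hj0
  have hα : IsSemialgebraicFunOn ℚ B (fun w => d₀.θ w - (bandUpper ξ 0 w).toReal) :=
    (IsSemialgebraicFunOn.sub_holds d₀.θ_sa (soloInformed_sa_bandUpper_toReal hB hξ 0)).congr
      fun _ _ => rfl
  refine soloInformed_locus_side_top ihI hS hα d₀.r (fun w hw => ?_)
  have hu : bandUpper ξ 0 w = ((ξ (Fin.castPred 0 hjl) w : ℝ) : EReal) :=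
    bandUpper_of_ne_last ξ 0 hjl w
  have hlu : bandLower ξ 0 w < bandUpper ξ 0 w := by
    rw [bandLower_zero, hu]; exact EReal.bot_lt_coe _
  rcases soloInformed_band_I_normalised d₀ hw hlu with ⟨h, -⟩ | ⟨huθ, hI⟩
  · exfalso
    rw [bandLower_zero, le_bot_iff] at h
    exact EReal.coe_ne_bot _ h
  · refine ⟨(soloInformed_normalised_below huθ hlu).1, ?_⟩
    change soloInformedBandI d₀ w = _ at hI
    rw [show ((d₀.θ w : ℝ) : EReal) - bandLower ξ 0 w = ⊤ by
      rw [bandLower_zero, EReal.coe_sub_bot]] at hI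
    exact hI

/-- Upper half-line fibres (`j = last ≠ 0`). -/
theorem soloInformed_band_locus_upper (ihI : SoloInformedFinLocusAt k m)
    (hB : IsSemialgebraic ℚ B) (hξ : ∀ i, IsSemialgebraicFunOn ℚ B (ξ i))
    (d₀ : SoloInformedLRData B (bandOver B ξ j) F)
    (hS : SoloInformedLocusHyp B d₀.a H₀W (soloInformedBandI d₀) c)
    (hj0 : j ≠ 0) (hjl : j = Fin.last l) :
    IsSemialgebraic ℚ {t : Fin k → ℝ | ∫⁻ x, B.indicator H₀W (Fin.append t x) < ∞} := by
  subst hjl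
  have hα : IsSemialgebraicFunOn ℚ B (fun w => (bandLower ξ (Fin.last l) w).toReal - d₀.θ w) :=
    (IsSemialgebraicFunOn.sub_holds (soloInformed_sa_bandLower_toReal hB hξ _) d₀.θ_sa).congr
      fun _ _ => rfl
  refine soloInformed_locus_side_top ihI hS hα d₀.r (fun w hw => ?_)
  have hl : bandLower ξ (Fin.last l) w = ((ξ (Fin.pred (Fin.last l) hj0) w : ℝ) : EReal) :=
    bandLower_of_ne_zero ξ _ hj0 w
  have hlu : bandLower ξ (Fin.last l) w < bandUpper ξ (Fin.last l) w := by
    rw [bandUpper_last, hl]; exact EReal.coe_lt_top _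
  rcases soloInformed_band_I_normalised d₀ hw hlu with ⟨hθl, hI⟩ | ⟨h, -⟩
  · refine ⟨(soloInformed_normalised_above hθl hlu).1, ?_⟩
    change soloInformedBandI d₀ w = _ at hI
    rw [show bandUpper ξ (Fin.last l) w - ((d₀.θ w : ℝ) : EReal) = ⊤ by
      rw [bandUpper_last, EReal.top_sub_coe]] at hI
    exact hI
  · exfalso
    rw [bandUpper_last, top_le_iff] at h
    exact EReal.coe_ne_top _ h

/-- Bounded fibres (`0 ≠ j ≠ last`): the base splits into the sides `{θ ≤ l}` and `{u ≤ θ}`. -/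
theorem soloInformed_band_locus_middle (ihI : SoloInformedFinLocusAt k m)
    (ihT : SoloInformedLogRoomAt k m)
    (hB : IsSemialgebraic ℚ B) (hξ : ∀ i, IsSemialgebraicFunOn ℚ B (ξ i))
    (d₀ : SoloInformedLRData B (bandOver B ξ j) F)
    (hS : SoloInformedLocusHyp B d₀.a H₀W (soloInformedBandI d₀) c)
    (hempty : ∀ w ∈ B, ¬ bandLower ξ j w < bandUpper ξ j w → H₀W w = 0)
    (hj0 : j ≠ 0) (hjl : j ≠ Fin.last l) :
    IsSemialgebraic ℚ {t : Fin k → ℝ | ∫⁻ x, B.indicator H₀W (Fin.append t x) < ∞} := by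
  have hlo := soloInformed_sa_bandLower_toReal hB hξ j
  have hup := soloInformed_sa_bandUpper_toReal hB hξ j
  have hl : ∀ w, bandLower ξ j w = ((ξ (j.pred hj0) w : ℝ) : EReal) := bandLower_of_ne_zero ξ j hj0
  have hu : ∀ w, bandUpper ξ j w = ((ξ (j.castPred hjl) w : ℝ) : EReal) :=
    bandUpper_of_ne_last ξ j hjl
  have hplus : IsSemialgebraic ℚ {w | w ∈ B ∧ 0 ≤ ((fun w => (bandLower ξ j w).toReal) - d₀.θ) w} :=
    (IsSemialgebraicFunOn.sub_holds hlo d₀.θ_sa).isSemialgebraic_sep_nonneg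
  have hminus : IsSemialgebraic ℚ {w | w ∈ B ∧ 0 ≤ (d₀.θ - fun w => (bandUpper ξ j w).toReal) w} :=
    (IsSemialgebraicFunOn.sub_holds d₀.θ_sa hup).isSemialgebraic_sep_nonneg
  refine soloInformed_locus_of_cover (B := B)
    (fun bb : Bool => cond bb {w | w ∈ B ∧ 0 ≤ ((fun w => (bandLower ξ j w).toReal) - d₀.θ) w}
      {w | w ∈ B ∧ 0 ≤ (d₀.θ - fun w => (bandUpper ξ j w).toReal) w})
    (by rintro (_ | _) w hw; exacts [hw.1, hw.1])
    (soloInformed_measurableSet_cond hplus hminus) hS.meas_H₀ (fun w hw => Or.inr ?_) ?_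
  · rcases soloInformed_EIoo_side (d₀.θ_notMem hw) with h | h
    · refine ⟨true, hw, ?_⟩
      show 0 ≤ (bandLower ξ j w).toReal - d₀.θ w
      rw [hl w, EReal.toReal_coe]
      rw [hl w, EReal.coe_le_coe_iff] at h
      linarith
    · refine ⟨false, hw, ?_⟩
      show 0 ≤ d₀.θ w - (bandUpper ξ j w).toReal
      rw [hu w, EReal.toReal_coe]
      rw [hu w, EReal.coe_le_coe_iff] at h
      linarith
  · rintro (_ | _)
    · -- the side `u ≤ θ`: `α = θ − u`, `b = θ − l`
      refine soloInformed_locus_side_fin ihI ihT (hS.mono (fun w hw => hw.1) hminus)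
        (α := fun w => d₀.θ w - (bandUpper ξ j w).toReal)
        (b := fun w => d₀.θ w - (bandLower ξ j w).toReal)
        (((IsSemialgebraicFunOn.sub_holds d₀.θ_sa hup).mono (fun w hw => hw.1) hminus).congr
          fun _ _ => rfl)
        (((IsSemialgebraicFunOn.sub_holds d₀.θ_sa hlo).mono (fun w hw => hw.1) hminus).congr
          fun _ _ => rfl)
        d₀.r (fun w hw => ?_)
      obtain ⟨hwB, hw0⟩ := hw
      have hw0' : 0 ≤ d₀.θ w - (bandUpper ξ j w).toReal := hw0
      rw [hu w, EReal.toReal_coe] at hw0'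
      refine ⟨by rw [hu w, EReal.toReal_coe]; exact hw0', fun hab => ?_, fun hba => ?_⟩
      · rw [hu w, hl w, EReal.toReal_coe, EReal.toReal_coe] at hab ⊢
        have hlu : bandLower ξ j w < bandUpper ξ j w := by
          rw [hl w, hu w, EReal.coe_lt_coe_iff]; linarith
        rcases soloInformed_band_I_normalised d₀ hwB hlu with ⟨h, -⟩ | ⟨-, hI⟩
        · exfalso
          rw [hl w, EReal.coe_le_coe_iff] at h
          linarith
        · change soloInformedBandI d₀ w = _ at hI
          rw [hu w, hl w, EReal.toReal_coe, ← EReal.coe_sub] at hI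
          exact hI
      · refine hempty w hwB fun hlu => ?_
        rw [hl w, hu w, EReal.coe_lt_coe_iff] at hlu
        rw [hl w, hu w, EReal.toReal_coe, EReal.toReal_coe] at hba
        linarith
    · -- the side `θ ≤ l`: `α = l − θ`, `b = u − θ`
      refine soloInformed_locus_side_fin ihI ihT (hS.mono (fun w hw => hw.1) hplus)
        (α := fun w => (bandLower ξ j w).toReal - d₀.θ w)
        (b := fun w => (bandUpper ξ j w).toReal - d₀.θ w)
        (((IsSemialgebraicFunOn.sub_holds hlo d₀.θ_sa).mono (fun w hw => hw.1) hplus).congr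
          fun _ _ => rfl)
        (((IsSemialgebraicFunOn.sub_holds hup d₀.θ_sa).mono (fun w hw => hw.1) hplus).congr
          fun _ _ => rfl)
        d₀.r (fun w hw => ?_)
      obtain ⟨hwB, hw0⟩ := hw
      have hw0' : 0 ≤ (bandLower ξ j w).toReal - d₀.θ w := hw0
      rw [hl w, EReal.toReal_coe] at hw0'
      refine ⟨by rw [hl w, EReal.toReal_coe]; exact hw0', fun hab => ?_, fun hba => ?_⟩
      · rw [hu w, hl w, EReal.toReal_coe, EReal.toReal_coe] at hab ⊢
        have hlu : bandLower ξ j w < bandUpper ξ j w := by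
          rw [hl w, hu w, EReal.coe_lt_coe_iff]; linarith
        rcases soloInformed_band_I_normalised d₀ hwB hlu with ⟨-, hI⟩ | ⟨h, -⟩
        · change soloInformedBandI d₀ w = _ at hI
          rw [hu w, hl w, EReal.toReal_coe, ← EReal.coe_sub] at hI
          exact hI
        · exfalso
          rw [hu w, EReal.coe_le_coe_iff] at h
          linarith
      · refine hempty w hwB fun hlu => ?_
        rw [hl w, hu w, EReal.coe_lt_coe_iff] at hlu
        rw [hl w, hu w, EReal.toReal_coe, EReal.toReal_coe] at hba
        linarith

/-- **The sides of a prepared band**: the locus over the base is `ℚ`-semialgebraic. -/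
theorem soloInformed_band_locus_sides (ihI : SoloInformedFinLocusAt k m)
    (ihT : SoloInformedLogRoomAt k m)
    (hB : IsSemialgebraic ℚ B) (hξ : ∀ i, IsSemialgebraicFunOn ℚ B (ξ i))
    (d₀ : SoloInformedLRData B (bandOver B ξ j) F)
    (hS : SoloInformedLocusHyp B d₀.a H₀W (soloInformedBandI d₀) c)
    (hempty : ∀ w ∈ B, ¬ bandLower ξ j w < bandUpper ξ j w → H₀W w = 0) :
    IsSemialgebraic ℚ {t : Fin k → ℝ | ∫⁻ x, B.indicator H₀W (Fin.append t x) < ∞} := by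
  by_cases hj0 : j = 0
  · by_cases hjl : j = Fin.last l
    · exact soloInformed_band_locus_line d₀ hj0 hjl
    · exact soloInformed_band_locus_lower ihI hB hξ d₀ hS hj0 hjl
  · by_cases hjl : j = Fin.last l
    · exact soloInformed_band_locus_upper ihI hB hξ d₀ hS hj0 hjl
    · exact soloInformed_band_locus_middle ihI ihT hB hξ d₀ hS hempty hj0 hjl

/-- **Integrability locus over a prepared band.**  If `F` carries Lion–Rolin data over the base
`B` of `D = bandOver B ξ j` and `H₀` agrees with `|F|` on `D`, the locus
`{t | ∫ D.indicator H₀ (t, ·) < ∞}` is `ℚ`-semialgebraic — granted LEMMA I and the log-room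
theorem in dimension `m`. -/
theorem soloInformed_band_locus (ihI : SoloInformedFinLocusAt k m)
    (ihT : SoloInformedLogRoomAt k m) (hB : IsSemialgebraic ℚ B)
    (hξ : ∀ i, IsSemialgebraicFunOn ℚ B (ξ i)) (j : Fin (l + 1))
    (d₀ : SoloInformedLRData B (bandOver B ξ j) F)
    {H₀ : (Fin (k + m + 1) → ℝ) → ℝ≥0∞} (hH₀m : Measurable H₀)
    (hH₀ : ∀ z ∈ bandOver B ξ j, H₀ z = ENNReal.ofReal |F z|) :
    IsSemialgebraic ℚ {t : Fin k → ℝ | ∫⁻ x : Fin (m + 1) → ℝ,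
      (bandOver B ξ j).indicator H₀ (Fin.append t x : Fin (k + (m + 1)) → ℝ) < ∞} := by
  have hD : MeasurableSet (bandOver B ξ j) :=
    (soloInformed_isSemialgebraic_bandOver hB hξ j).measurableSet_holds
  have hset : {t : Fin k → ℝ | ∫⁻ x : Fin (m + 1) → ℝ,
      (bandOver B ξ j).indicator H₀ (Fin.append t x : Fin (k + (m + 1)) → ℝ) < ∞} =
      {t | ∫⁻ x, B.indicator (soloInformedBandHW B ξ j H₀) (Fin.append t x) < ∞} := by
    ext t
    rw [mem_setOf_eq, mem_setOf_eq, soloInformed_lintegral_band_append hD hH₀m t,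
      ← soloInformed_bandHW_eq_indicator H₀]
  rw [hset]
  refine soloInformed_band_locus_sides ihI ihT hB hξ d₀ (soloInformed_band_locusHyp hB hξ d₀ hH₀m hH₀)
    (fun w hw hlu => ?_)
  rw [soloInformed_bandHW_congr hH₀ hw, soloInformed_EIoo_eq_empty hlu]
  simp

end Summit.KontsevichZagierPeriods.KontsevichZagierPeriods.Theorems
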